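import Summits.CriticalPhenomena.PercolationContinuityZ3.Theorems.PercNearOneGluingNoHeavyLowerTailThreePointPiecesClasses
import HarnessLib

/-!
# Star-shaped pieces, and `(3PT)` for parallel compositions of star-shaped and series pieces

Support file for crux `stmt-CriticalPhenomena-4575` (`NoHeavyLowerTail`), seat `prim-l12-p1` gen 20 (`--supports stmt-CriticalPhenomena-4575`);
continuation of `…ThreePointPieces*.lean`.  Memo `run/shared/lean/prim/prim-l12/FROM-prim-l12-p1-g20-*.md`.

A STAR-SHAPED PIECE is a piece `i` with a non-terminal CENTRE `h` and a ray labelling `ρ : V → V` such that every pair of the piece that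
avoids `h` lies inside a single ray `{x} ∪ {v : ρ v = x}` (`x` a terminal): the three rays are arbitrary two-terminal networks joining `h` to
`a`, to `b`, to `c` (a single hub is the case of empty rays; a subdivided star, parallel bundles of paths, … are others).  [this work]:

* `pieceConn_iff_rays` (ray closure): off the null event `starNull`, a terminal reaches another terminal inside the piece iff both reach
  the centre through their own rays;
* `real_starPiece`: the three ray events are determined by pairwise disjoint pair sets, hence independent, and the piece's isolation /
  separation probabilities are the SINGLE-HUB FORMULAS of Theorem H with the ray probabilities `α, β, γ` in place of the edge weights;
* `isoK_star`: so a star-shaped piece satisfies `(K)` (`star_isoK_*`);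
* `threePointVariance_of_stars_and_series`: **`(3PT)` holds, for all weights, on every parallel composition at `{a,b,c}` of star-shaped
  pieces and series pieces** — the `∥`-closed class generated by three-terminal stars with arbitrary two-terminal networks as rays and by
  terminal-cut-vertex pieces; it contains `threePointVariance_of_hubs_and_series` and Theorem H.
-/

namespace Summit.CriticalPhenomena.PercolationContinuityZ3.Theorems.ThreePointPieces

open MeasureTheory Set
open Literature.Probability.Percolation Literature.Probability.LatticeModels

variable {V : Type*} [Fintype V] [DecidableEq V] {ι : Type*} [DecidableEq ι]

/-! ## Pieces that satisfy `(K)`: star-shaped pieces (a centre `h` whose three rays are arbitrary two-terminal networks) -/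

section starPiece
variable (w : Sym2 V → unitInterval) {a b c : V} (part : V → ι) (i : ι) (h : V) (ρ : V → V)

/-- The pairs of piece `i` inside the `x`-ray `{x, h} ∪ {v : ρ v = x}`. [this work] -/
def rayPairs (a b c : V) (part : V → ι) (i : ι) (h : V) (ρ : V → V) (x : V) : Finset (Sym2 V) :=
  (piecePairs a b c part i).filter fun e => ∀ t, t ∈ e → (t = x ∨ t = h ∨ (t ∉ terms a b c ∧ part t = i ∧ t ≠ h ∧ ρ t = x))

/-- The null event of a star-shaped piece: some piece pair avoiding the centre `h` and not inside a single ray is open. [this work] -/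
def starNull (a b c : V) (part : V → ι) (i : ι) (h : V) (ρ : V → V) : Set (BondConfig V) :=
  {ω | ∃ u v, s(u, v) ∈ ω ∧ s(u, v) ∈ piecePairs a b c part i ∧ u ≠ h ∧ v ≠ h ∧
    ¬ ∃ x, x ∈ terms a b c ∧ (u = x ∨ (u ∉ terms a b c ∧ part u = i ∧ ρ u = x)) ∧ (v = x ∨ (v ∉ terms a b c ∧ part v = i ∧ ρ v = x))}

/-- "`x` reaches the centre `h` through its own ray". [this work] -/
def rayConn (a b c : V) (part : V → ι) (i : ι) (h : V) (ρ : V → V) (x : V) : Set (BondConfig V) :=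
  pieceConn (rayPairs a b c part i h ρ x) x h

variable {part i h ρ}

/-- `rayPairs ⊆ piecePairs`. [this work] -/
theorem rayPairs_subset (x : V) : rayPairs a b c part i h ρ x ⊆ piecePairs a b c part i := Finset.filter_subset _ _

/-- A piece pair with both ends in the `x`-ray is a ray pair. [this work] -/
theorem mk_mem_rayPairs {x u v : V} (he : s(u, v) ∈ piecePairs a b c part i)
    (hu : u = x ∨ u = h ∨ (u ∉ terms a b c ∧ part u = i ∧ u ≠ h ∧ ρ u = x))
    (hv : v = x ∨ v = h ∨ (v ∉ terms a b c ∧ part v = i ∧ v ≠ h ∧ ρ v = x)) : s(u, v) ∈ rayPairs a b c part i h ρ x := by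
  refine Finset.mem_filter.2 ⟨he, fun t ht => ?_⟩
  rcases Sym2.mem_iff.1 ht with rfl | rfl
  · exact hu
  · exact hv

/-- The ray pair sets of two distinct terminals are disjoint (`h` a non-terminal of the piece). [this work] -/
theorem disjoint_rayPairs {x y : V} (hx : x ∈ terms a b c) (hy : y ∈ terms a b c) (hxy : x ≠ y) (hh : h ∉ terms a b c) :
    Disjoint (rayPairs a b c part i h ρ x) (rayPairs a b c part i h ρ y) := by
  rw [Finset.disjoint_left]
  intro e heX heY
  obtain ⟨heF, hPX⟩ := Finset.mem_filter.1 heX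
  obtain ⟨-, hPY⟩ := Finset.mem_filter.1 heY
  obtain ⟨u, v, -, -, huv, rfl⟩ := mem_piecePairs.1 heF
  have key : ∀ t, t ∈ s(u, v) → t = h := by
    intro t ht
    rcases hPX t ht with rfl | rfl | ⟨htT, -, -, htx⟩
    · rcases hPY t ht with e | e | ⟨htT, -⟩
      · exact (hxy e).elim
      · exact e
      · exact (htT hx).elim
    · rfl
    · rcases hPY t ht with rfl | e | ⟨-, -, -, hty⟩
      · exact (htT hy).elim
      · exact e
      · exact (hxy (htx.symm.trans hty)).elim
  exact huv ((key u (Sym2.mem_mk_left u v)).trans (key v (Sym2.mem_mk_right u v)).symm)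

/-- The null event of a star-shaped piece is null when its cross pairs have weight `0`. [this work] -/
theorem real_starNull
    (hsep : ∀ u v : V, s(u, v) ∈ piecePairs a b c part i → u ≠ h → v ≠ h →
      (¬ ∃ x, x ∈ terms a b c ∧ (u = x ∨ (u ∉ terms a b c ∧ part u = i ∧ ρ u = x)) ∧ (v = x ∨ (v ∉ terms a b c ∧ part v = i ∧ ρ v = x))) →
      (w s(u, v) : ℝ) = 0) :
    (prodBernoulli w).real (starNull a b c part i h ρ) = 0 := by
  classical
  set P : Finset (Sym2 V) := ((Finset.univ ×ˢ Finset.univ).filter fun uv : V × V =>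
      s(uv.1, uv.2) ∈ piecePairs a b c part i ∧ uv.1 ≠ h ∧ uv.2 ≠ h ∧
        ¬ ∃ x, x ∈ terms a b c ∧ (uv.1 = x ∨ (uv.1 ∉ terms a b c ∧ part uv.1 = i ∧ ρ uv.1 = x)) ∧
          (uv.2 = x ∨ (uv.2 ∉ terms a b c ∧ part uv.2 = i ∧ ρ uv.2 = x))).image fun uv => s(uv.1, uv.2) with hP
  have hsub : starNull a b c part i h ρ ⊆ {ω : BondConfig V | ∃ e ∈ P, e ∈ ω} := by
    rintro ω ⟨u, v, he, heF, hu, hv, hno⟩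
    refine ⟨s(u, v), ?_, he⟩
    rw [hP, Finset.mem_image]
    exact ⟨(u, v), Finset.mem_filter.2 ⟨Finset.mem_product.2 ⟨Finset.mem_univ _, Finset.mem_univ _⟩, heF, hu, hv, hno⟩, rfl⟩
  refine le_antisymm ?_ measureReal_nonneg
  refine (measureReal_mono hsub).trans ((prodBernoulli_real_exists_mem_le_sum w P).trans (le_of_eq (Finset.sum_eq_zero ?_)))
  intro e he
  rw [hP, Finset.mem_image] at he
  obtain ⟨⟨u, v⟩, huv, rfl⟩ := he
  rw [Finset.mem_filter] at huv
  exact hsep u v huv.2.1 huv.2.2.1 huv.2.2.2.1 huv.2.2.2.2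

/-- **Ray closure.**  Off the null event, if `x` does not reach the centre through its own ray, then `x` reaches no other terminal
inside the piece. [this work] -/
theorem not_pieceConn_of_not_rayConn (hh : h ∉ terms a b c) (hhi : part h = i) {x y : V} (hx : x ∈ terms a b c)
    (hy : y ∈ terms a b c) (hxy : x ≠ y) {ω : BondConfig V} (hN : ω ∉ starNull a b c part i h ρ)
    (hR : ω ∉ rayConn a b c part i h ρ x) : ω ∉ pieceConn (piecePairs a b c part i) x y := by
  set F := piecePairs a b c part i with hF
  set R : Set V := {v | v = x ∨ ((v ∉ terms a b c ∧ part v = i ∧ v ≠ h ∧ ρ v = x) ∧ ω ∈ pieceConn (rayPairs a b c part i h ρ x) x v)}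
    with hRdef
  have hreach : ∀ u ∈ R, ω ∈ pieceConn (rayPairs a b c part i h ρ x) x u := by
    rintro u (rfl | ⟨-, hu⟩)
    · exact SimpleGraph.Reachable.refl _
    · exact hu
  have hside : ∀ u ∈ R, u = x ∨ u = h ∨ (u ∉ terms a b c ∧ part u = i ∧ u ≠ h ∧ ρ u = x) := by
    rintro u (rfl | ⟨hu, -⟩)
    · exact Or.inl rfl
    · exact Or.inr (Or.inr hu)
  have hneh : ∀ u ∈ R, u ≠ h := by
    rintro u (rfl | ⟨hu, -⟩)
    · exact fun e => hh (e ▸ hx)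
    · exact hu.2.2.1
  have hcl : ∀ u v, (openGraph (ω ∩ ↑F)).Adj u v → u ∈ R → v ∈ R := by
    intro u v huv hu
    rw [openGraph_adj] at huv
    obtain ⟨⟨he, heF⟩, hne⟩ := huv
    have heF' : s(u, v) ∈ F := Finset.mem_coe.1 heF
    obtain ⟨-, hv1, -⟩ := mem_piecePairs_mk heF'
    have step : (v = x ∨ v = h ∨ (v ∉ terms a b c ∧ part v = i ∧ v ≠ h ∧ ρ v = x)) →
        ω ∈ pieceConn (rayPairs a b c part i h ρ x) x v := fun hv =>
      (hreach u hu).trans (SimpleGraph.Adj.reachable ((openGraph_adj _ _ _).2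
        ⟨⟨he, Finset.mem_coe.2 (mk_mem_rayPairs heF' (hside u hu) hv)⟩, hne⟩))
    by_cases hvh : v = h
    · -- reaching the centre contradicts `hR`
      have h' := step (Or.inr (Or.inl hvh))
      rw [hvh] at h'
      exact (hR h').elim
    by_cases hvx : v = x
    · exact Or.inl hvx
    by_cases hvray : v ∉ terms a b c ∧ part v = i ∧ v ≠ h ∧ ρ v = x
    · exact Or.inr ⟨hvray, step (Or.inr (Or.inr hvray))⟩
    · -- otherwise `s(u,v)` is a null pair
      exfalso
      refine hN ⟨u, v, he, heF', hneh u hu, hvh, ?_⟩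
      rintro ⟨x', hx', hux', hvx'⟩
      -- `u` lies on the `x`-side only
      have hxx' : x' = x := by
        rcases hside u hu with rfl | rfl | ⟨huT, -, -, hux⟩
        · rcases hux' with e | ⟨huT, -⟩
          · exact e.symm
          · exact (huT hx).elim
        · exact ((hneh _ hu) rfl).elim
        · rcases hux' with rfl | ⟨-, -, e⟩
          · exact (huT hx').elim
          · exact e.symm.trans hux
      subst hxx'
      rcases hvx' with e | ⟨hvT, hvi, hvρ⟩
      · exact hvx e
      · exact hvray ⟨hvT, hvi, hvh, hvρ⟩
  have hstay : ∀ {u v : V} (_ : (openGraph (ω ∩ ↑F)).Walk u v), u ∈ R → v ∈ R := by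
    intro u v q
    induction q with
    | nil => exact id
    | cons h' _ ih => exact fun hu => ih (hcl _ _ h' hu)
  have hyR : y ∉ R := by
    rintro (e | ⟨⟨hyT, -⟩, -⟩)
    · exact hxy e.symm
    · exact hyT hy
  exact fun ⟨p⟩ => hyR (hstay p (Or.inl rfl))

/-- **Terminal-to-terminal connection inside a star-shaped piece = both rays reach the centre** (off the null event). [this work] -/
theorem pieceConn_iff_rays (hh : h ∉ terms a b c) (hhi : part h = i) {x y : V} (hx : x ∈ terms a b c) (hy : y ∈ terms a b c)
    (hxy : x ≠ y) {ω : BondConfig V} (hN : ω ∉ starNull a b c part i h ρ) :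
    ω ∈ pieceConn (piecePairs a b c part i) x y ↔ ω ∈ rayConn a b c part i h ρ x ∧ ω ∈ rayConn a b c part i h ρ y := by
  constructor
  · intro hc
    by_contra hno
    rcases not_and_or.1 hno with h1 | h1
    · exact not_pieceConn_of_not_rayConn hh hhi hx hy hxy hN h1 hc
    · exact not_pieceConn_of_not_rayConn hh hhi hy hx (Ne.symm hxy) hN h1 (SimpleGraph.Reachable.symm hc)
  · rintro ⟨h1, h2⟩
    have m1 : ω ∩ ↑(rayPairs a b c part i h ρ x) ⊆ ω ∩ ↑(piecePairs a b c part i) :=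
      inter_subset_inter_right _ (Finset.coe_subset.2 (rayPairs_subset x))
    have m2 : ω ∩ ↑(rayPairs a b c part i h ρ y) ⊆ ω ∩ ↑(piecePairs a b c part i) :=
      inter_subset_inter_right _ (Finset.coe_subset.2 (rayPairs_subset y))
    exact (SimpleGraph.Reachable.mono (openGraph_mono m1) h1).trans
      (SimpleGraph.Reachable.symm (SimpleGraph.Reachable.mono (openGraph_mono m2) h2))

/-- Off the null event, `isoPiece x y z` is the event "not (ray `x` and (ray `y` or ray `z`))". [this work] -/
theorem isoPiece_inter_eq_rays (hh : h ∉ terms a b c) (hhi : part h = i) {x y z : V} (hx : x ∈ terms a b c)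
    (hy : y ∈ terms a b c) (hz : z ∈ terms a b c) (hxy : x ≠ y) (hxz : x ≠ z) :
    isoPiece (piecePairs a b c part i) x y z ∩ (starNull a b c part i h ρ)ᶜ =
      (rayConn a b c part i h ρ x ∩ (rayConn a b c part i h ρ y ∪ rayConn a b c part i h ρ z))ᶜ ∩ (starNull a b c part i h ρ)ᶜ := by
  ext ω
  simp only [isoPiece, mem_inter_iff, mem_compl_iff, mem_union]
  constructor
  · rintro ⟨⟨h1, h2⟩, hN⟩
    refine ⟨fun ⟨hrx, hyz⟩ => ?_, hN⟩
    rcases hyz with hry | hrz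
    · exact h1 ((pieceConn_iff_rays hh hhi hx hy hxy hN).2 ⟨hrx, hry⟩)
    · exact h2 ((pieceConn_iff_rays hh hhi hx hz hxz hN).2 ⟨hrx, hrz⟩)
  · rintro ⟨hno, hN⟩
    refine ⟨⟨fun h1 => hno ?_, fun h2 => hno ?_⟩, hN⟩
    · obtain ⟨hrx, hry⟩ := (pieceConn_iff_rays hh hhi hx hy hxy hN).1 h1
      exact ⟨hrx, Or.inl hry⟩
    · obtain ⟨hrx, hrz⟩ := (pieceConn_iff_rays hh hhi hx hz hxz hN).1 h2
      exact ⟨hrx, Or.inr hrz⟩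

/-- `rayConn x` is determined by the `x`-ray pairs. [this work] -/
theorem determinedBy_rayConn (x : V) : DeterminedBy (rayConn a b c part i h ρ x) (↑(rayPairs a b c part i h ρ x) : Set (Sym2 V)) :=
  determinedBy_pieceConn _ x h

/-- **Probabilities of the ray events**: with `α, β, γ` the probabilities that `a, b, c` reach the centre through their rays,
`P(isoPiece a b c) = 1 − α(1 − (1−β)(1−γ))` and `P(separated inside) = 1 − αβ − αγ − βγ + 2αβγ` — the single-hub formulas of Theorem H
with the ray probabilities in place of the edge weights. [this work] -/
theorem real_starPiece (hab : a ≠ b) (hac : a ≠ c) (hbc : b ≠ c) (hh : h ∉ terms a b c) (hhi : part h = i)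
    (hsep : ∀ u v : V, s(u, v) ∈ piecePairs a b c part i → u ≠ h → v ≠ h →
      (¬ ∃ x, x ∈ terms a b c ∧ (u = x ∨ (u ∉ terms a b c ∧ part u = i ∧ ρ u = x)) ∧ (v = x ∨ (v ∉ terms a b c ∧ part v = i ∧ ρ v = x))) →
      (w s(u, v) : ℝ) = 0) :
    let F := piecePairs a b c part i
    let α := (prodBernoulli w).real (rayConn a b c part i h ρ a)
    let β := (prodBernoulli w).real (rayConn a b c part i h ρ b)
    let γ := (prodBernoulli w).real (rayConn a b c part i h ρ c)
    (prodBernoulli w).real (isoPiece F a b c) = 1 - α * (1 - (1 - β) * (1 - γ)) ∧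
      (prodBernoulli w).real (isoPiece F b a c) = 1 - β * (1 - (1 - α) * (1 - γ)) ∧
      (prodBernoulli w).real (isoPiece F c a b) = 1 - γ * (1 - (1 - α) * (1 - β)) ∧
      (prodBernoulli w).real (isoPiece F a b c ∩ isoPiece F b a c) = 1 - α * β - α * γ - β * γ + 2 * α * β * γ := by
  intro F α β γ
  have ha : a ∈ terms a b c := mem_terms.2 (Or.inl rfl)
  have hb : b ∈ terms a b c := mem_terms.2 (Or.inr (Or.inl rfl))
  have hc : c ∈ terms a b c := mem_terms.2 (Or.inr (Or.inr rfl))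
  set N := starNull a b c part i h ρ with hNdef
  have hN : (prodBernoulli w).real N = 0 := real_starNull w hsep
  set Ra := rayConn a b c part i h ρ a
  set Rb := rayConn a b c part i h ρ b
  set Rc := rayConn a b c part i h ρ c
  -- independence of the three ray events (pairwise disjoint determining pair sets)
  have dab := disjoint_rayPairs (part := part) (i := i) (ρ := ρ) ha hb hab hh
  have dac := disjoint_rayPairs (part := part) (i := i) (ρ := ρ) ha hc hac hh
  have dbc := disjoint_rayPairs (part := part) (i := i) (ρ := ρ) hb hc hbc hh
  have det := fun x => determinedBy_rayConn (a := a) (b := b) (c := c) (part := part) (i := i) (h := h) (ρ := ρ) x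
  have cdet := fun x => OneLayerTwoFinger.determinedBy_compl (determinedBy_rayConn (a := a) (b := b) (c := c) (part := part)
    (i := i) (h := h) (ρ := ρ) x)
  have M : ∀ s : Set (BondConfig V), MeasurableSet s := fun _ => MeasurableSet.of_discrete
  -- two-event products
  have ind2 : ∀ {x y : V} (hd : Disjoint (rayPairs a b c part i h ρ x) (rayPairs a b c part i h ρ y)) (S T : Set (BondConfig V)),
      DeterminedBy S ↑(rayPairs a b c part i h ρ x) → DeterminedBy T ↑(rayPairs a b c part i h ρ y) →
      (prodBernoulli w).real (S ∩ T) = (prodBernoulli w).real S * (prodBernoulli w).real T :=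
    fun hd S T hS hT => prodBernoulli_real_inter_of_determinedBy_disjoint w hd hS hT (M _) (M _)
  -- P((Ry ∪ Rz)ᶜ) = (1 - P Ry)(1 - P Rz) for disjoint rays
  have cu : ∀ {y z : V} (hd : Disjoint (rayPairs a b c part i h ρ y) (rayPairs a b c part i h ρ z)),
      (prodBernoulli w).real (rayConn a b c part i h ρ y ∪ rayConn a b c part i h ρ z) =
        1 - (1 - (prodBernoulli w).real (rayConn a b c part i h ρ y)) * (1 - (prodBernoulli w).real (rayConn a b c part i h ρ z)) := by
    intro y z hd
    have e : (rayConn a b c part i h ρ y ∪ rayConn a b c part i h ρ z) = ((rayConn a b c part i h ρ y)ᶜ ∩ (rayConn a b c part i h ρ z)ᶜ)ᶜ := by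
      rw [← compl_union, compl_compl]
    rw [e, probReal_compl_eq_one_sub (M _), ind2 hd _ _ (cdet y) (cdet z), probReal_compl_eq_one_sub (M _),
      probReal_compl_eq_one_sub (M _)]
  -- the isolation formula for a generic ordering
  have iso : ∀ {x y z : V} (hx : x ∈ terms a b c) (hy : y ∈ terms a b c) (hz : z ∈ terms a b c) (hxy : x ≠ y) (hxz : x ≠ z)
      (hdxy : Disjoint (rayPairs a b c part i h ρ x) (rayPairs a b c part i h ρ y))
      (hdxz : Disjoint (rayPairs a b c part i h ρ x) (rayPairs a b c part i h ρ z))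
      (hdyz : Disjoint (rayPairs a b c part i h ρ y) (rayPairs a b c part i h ρ z)),
      (prodBernoulli w).real (isoPiece F x y z) =
        1 - (prodBernoulli w).real (rayConn a b c part i h ρ x) *
          (1 - (1 - (prodBernoulli w).real (rayConn a b c part i h ρ y)) * (1 - (prodBernoulli w).real (rayConn a b c part i h ρ z))) := by
    intro x y z hx hy hz hxy hxz hdxy hdxz hdyz
    have e := isoPiece_inter_eq_rays (part := part) (i := i) (ρ := ρ) hh hhi hx hy hz hxy hxz
    rw [← ThreePointVarianceCutVertex.real_inter_compl_of_null w hN (isoPiece F x y z), e,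
      ThreePointVarianceCutVertex.real_inter_compl_of_null w hN, probReal_compl_eq_one_sub (M _)]
    have hdet : DeterminedBy (rayConn a b c part i h ρ y ∪ rayConn a b c part i h ρ z)
        ↑(rayPairs a b c part i h ρ y ∪ rayPairs a b c part i h ρ z) := by
      have e' : (rayConn a b c part i h ρ y ∪ rayConn a b c part i h ρ z) =
          ((rayConn a b c part i h ρ y)ᶜ ∩ (rayConn a b c part i h ρ z)ᶜ)ᶜ := by rw [← compl_union, compl_compl]
      rw [e', Finset.coe_union]
      exact OneLayerTwoFinger.determinedBy_compl (((cdet y).mono subset_union_left).inter ((cdet z).mono subset_union_right))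
    rw [prodBernoulli_real_inter_of_determinedBy_disjoint w (Finset.disjoint_union_right.2 ⟨hdxy, hdxz⟩) (det x) hdet (M _) (M _),
      cu hdyz]
  refine ⟨iso ha hb hc hab hac dab dac dbc, iso hb ha hc (Ne.symm hab) hbc dab.symm dbc dac,
    iso hc ha hb (Ne.symm hac) (Ne.symm hbc) dac.symm dbc.symm dab, ?_⟩
  -- separation, by inclusion–exclusion: `iso_a ∪ iso_b = (R_a ∩ R_b)ᶜ` off the null event
  have e := isoPiece_inter_eq_rays (part := part) (i := i) (ρ := ρ) hh hhi ha hb hc hab hac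
  have e' := isoPiece_inter_eq_rays (part := part) (i := i) (ρ := ρ) hh hhi hb ha hc (Ne.symm hab) hbc
  have eU : (isoPiece F a b c ∪ isoPiece F b a c) ∩ Nᶜ = (Ra ∩ Rb)ᶜ ∩ Nᶜ := by
    ext ω
    simp only [mem_inter_iff, mem_union, mem_compl_iff]
    constructor
    · rintro ⟨h12, hn⟩
      refine ⟨fun ⟨hA, hB⟩ => ?_, hn⟩
      rcases h12 with h1 | h2
      · have h1' : ω ∈ (Ra ∩ (Rb ∪ Rc))ᶜ ∩ Nᶜ := by rw [← e]; exact ⟨h1, hn⟩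
        exact h1'.1 ⟨hA, Or.inl hB⟩
      · have h2' : ω ∈ (Rb ∩ (Ra ∪ Rc))ᶜ ∩ Nᶜ := by rw [← e']; exact ⟨h2, hn⟩
        exact h2'.1 ⟨hB, Or.inl hA⟩
    · rintro ⟨hno, hn⟩
      refine ⟨?_, hn⟩
      by_cases hA : ω ∈ Ra
      · right
        have g : ω ∈ (Rb ∩ (Ra ∪ Rc))ᶜ ∩ Nᶜ := ⟨fun ⟨hB, _⟩ => hno ⟨hA, hB⟩, hn⟩
        rw [← e'] at g
        exact g.1
      · left
        have g : ω ∈ (Ra ∩ (Rb ∪ Rc))ᶜ ∩ Nᶜ := ⟨fun ⟨hA', _⟩ => hA hA', hn⟩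
        rw [← e] at g
        exact g.1
  have rU : (prodBernoulli w).real (isoPiece F a b c ∪ isoPiece F b a c) = 1 - α * β := by
    rw [← ThreePointVarianceCutVertex.real_inter_compl_of_null w hN (isoPiece F a b c ∪ isoPiece F b a c), eU,
      ThreePointVarianceCutVertex.real_inter_compl_of_null w hN, probReal_compl_eq_one_sub (M _), ind2 dab _ _ (det a) (det b)]
  have hIE := measureReal_union_add_inter (μ := prodBernoulli w) (s := isoPiece F a b c) (t := isoPiece F b a c) (M _)
  rw [rU, iso ha hb hc hab hac dab dac dbc, iso hb ha hc (Ne.symm hab) hbc dab.symm dbc dac] at hIE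
  linear_combination hIE

/-- **A star-shaped piece satisfies `(K)`** (in the form used by `threePointVariance_of_pieces`): a non-terminal centre `h` and a ray
labelling `ρ` such that every piece pair avoiding `h` lies inside a single ray `{x} ∪ {v : ρ v = x}` (e.g. a subdivided star, or three
arbitrary two-terminal networks joining `h` to `a`, `b`, `c`). [this work] -/
theorem isoK_star (hab : a ≠ b) (hac : a ≠ c) (hbc : b ≠ c) (hh : h ∉ terms a b c) (hhi : part h = i)
    (hsep : ∀ u v : V, s(u, v) ∈ piecePairs a b c part i → u ≠ h → v ≠ h →
      (¬ ∃ x, x ∈ terms a b c ∧ (u = x ∨ (u ∉ terms a b c ∧ part u = i ∧ ρ u = x)) ∧ (v = x ∨ (v ∉ terms a b c ∧ part v = i ∧ ρ v = x))) →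
      (w s(u, v) : ℝ) = 0) :
    let F := piecePairs a b c part i
    (prodBernoulli w).real (isoPiece F a b c ∩ isoPiece F b a c) ^ 3 ≤
        (prodBernoulli w).real (isoPiece F c a b) ^ 2 * (prodBernoulli w).real (isoPiece F b a c) *
          (prodBernoulli w).real (isoPiece F a b c) ∧
      (prodBernoulli w).real (isoPiece F a b c ∩ isoPiece F b a c) ^ 3 ≤
        (prodBernoulli w).real (isoPiece F c a b) * (prodBernoulli w).real (isoPiece F b a c) ^ 2 *
          (prodBernoulli w).real (isoPiece F a b c) ∧
      (prodBernoulli w).real (isoPiece F a b c ∩ isoPiece F b a c) ^ 3 ≤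
        (prodBernoulli w).real (isoPiece F c a b) * (prodBernoulli w).real (isoPiece F b a c) *
          (prodBernoulli w).real (isoPiece F a b c) ^ 2 := by
  intro F
  obtain ⟨rC, rB, rA, rQ⟩ := real_starPiece w (part := part) (i := i) (h := h) (ρ := ρ) hab hac hbc hh hhi hsep
  set α := (prodBernoulli w).real (rayConn a b c part i h ρ a)
  set β := (prodBernoulli w).real (rayConn a b c part i h ρ b)
  set γ := (prodBernoulli w).real (rayConn a b c part i h ρ c)
  have h1 : 0 ≤ α := measureReal_nonneg
  have h2 : α ≤ 1 := measureReal_le_one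
  have h3 : 0 ≤ β := measureReal_nonneg
  have h4 : β ≤ 1 := measureReal_le_one
  have h5 : 0 ≤ γ := measureReal_nonneg
  have h6 : γ ≤ 1 := measureReal_le_one
  have eC : (prodBernoulli w).real (isoPiece F a b c) = 1 - α * (β + γ - β * γ) := by rw [rC]; ring
  have eB : (prodBernoulli w).real (isoPiece F b a c) = 1 - β * (α + γ - α * γ) := by rw [rB]; ring
  have eA : (prodBernoulli w).real (isoPiece F c a b) = 1 - γ * (α + β - α * β) := by rw [rA]; ring
  rw [rQ, eA, eB, eC]
  exact ⟨ThreePointIsoProduct.star_isoK_A h1 h2 h3 h4 h5 h6, ThreePointIsoProduct.star_isoK_B h1 h2 h3 h4 h5 h6,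
    ThreePointIsoProduct.star_isoK_C h1 h2 h3 h4 h5 h6⟩

end starPiece

/-! ## `(3PT)` for parallel compositions of star-shaped and series pieces -/

/-- **The three-point variance row for every parallel composition of star-shaped pieces and series pieces, all weights.**
Hypotheses as in `threePointVariance_of_hubs_and_series`, with "single hub" replaced by "star-shaped piece with centre `h` and ray
labelling `ρ`" (every piece pair avoiding `h` lies inside one ray).  Conclusion:
`P(a↔b)·P(a↮b) ≤ P(a↔b, a↮c) + P(a↔c, a↮b) + P(b↔c, a↮b)`. [this work] -/
theorem threePointVariance_of_stars_and_series [Fintype ι] (w : Sym2 V → unitInterval) {a b c : V} (hab : a ≠ b) (hac : a ≠ c)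
    (hbc : b ≠ c) (part : V → ι) (hw : ∀ u v : V, u ∉ terms a b c → v ∉ terms a b c → part u ≠ part v → (w s(u, v) : ℝ) = 0)
    (hkind : ∀ i, (∃ (h : V) (ρ : V → V), h ∉ terms a b c ∧ part h = i ∧
        ∀ u v : V, s(u, v) ∈ piecePairs a b c part i → u ≠ h → v ≠ h →
          (¬ ∃ x, x ∈ terms a b c ∧ (u = x ∨ (u ∉ terms a b c ∧ part u = i ∧ ρ u = x)) ∧
            (v = x ∨ (v ∉ terms a b c ∧ part v = i ∧ ρ v = x))) → (w s(u, v) : ℝ) = 0) ∨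
      ∃ X : Finset V,
        (∀ u v : V, (u = a ∨ (u ∉ terms a b c ∧ part u = i ∧ u ∈ X)) → (v = b ∨ (v ∉ terms a b c ∧ part v = i ∧ v ∉ X)) →
          ((u ∉ terms a b c ∧ part u = i ∧ u ∈ X) ∨ (v ∉ terms a b c ∧ part v = i ∧ v ∉ X)) → (w s(u, v) : ℝ) = 0) ∨
        (∀ u v : V, (u = b ∨ (u ∉ terms a b c ∧ part u = i ∧ u ∈ X)) → (v = c ∨ (v ∉ terms a b c ∧ part v = i ∧ v ∉ X)) →
          ((u ∉ terms a b c ∧ part u = i ∧ u ∈ X) ∨ (v ∉ terms a b c ∧ part v = i ∧ v ∉ X)) → (w s(u, v) : ℝ) = 0) ∨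
        (∀ u v : V, (u = a ∨ (u ∉ terms a b c ∧ part u = i ∧ u ∈ X)) → (v = c ∨ (v ∉ terms a b c ∧ part v = i ∧ v ∉ X)) →
          ((u ∉ terms a b c ∧ part u = i ∧ u ∈ X) ∨ (v ∉ terms a b c ∧ part v = i ∧ v ∉ X)) → (w s(u, v) : ℝ) = 0)) :
    (prodBernoulli w).real (openConn a b) * (prodBernoulli w).real (openConn a b)ᶜ ≤
      (prodBernoulli w).real (openConn a b ∩ (openConn a c)ᶜ) + (prodBernoulli w).real (openConn a c ∩ (openConn a b)ᶜ) +
        (prodBernoulli w).real (openConn b c ∩ (openConn a b)ᶜ) := by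
  have hK : ∀ i, let F := piecePairs a b c part i
      (prodBernoulli w).real (isoPiece F a b c ∩ isoPiece F b a c) ^ 3 ≤
          (prodBernoulli w).real (isoPiece F c a b) ^ 2 * (prodBernoulli w).real (isoPiece F b a c) *
            (prodBernoulli w).real (isoPiece F a b c) ∧
        (prodBernoulli w).real (isoPiece F a b c ∩ isoPiece F b a c) ^ 3 ≤
          (prodBernoulli w).real (isoPiece F c a b) * (prodBernoulli w).real (isoPiece F b a c) ^ 2 *
            (prodBernoulli w).real (isoPiece F a b c) ∧
        (prodBernoulli w).real (isoPiece F a b c ∩ isoPiece F b a c) ^ 3 ≤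
          (prodBernoulli w).real (isoPiece F c a b) * (prodBernoulli w).real (isoPiece F b a c) *
            (prodBernoulli w).real (isoPiece F a b c) ^ 2 := by
    intro i
    rcases hkind i with ⟨h, ρ, hh, hhi, hs⟩ | ⟨X, hX⟩
    · exact isoK_star w (part := part) (i := i) (h := h) (ρ := ρ) hab hac hbc hh hhi hs
    · exact isoK_series w part i hab hac hbc X hX
  exact threePointVariance_of_pieces w hab hac hbc part hw (fun i => (hK i).1) (fun i => (hK i).2.1) (fun i => (hK i).2.2)

end Summit.CriticalPhenomena.PercolationContinuityZ3.Theorems.ThreePointPieces
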